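import Summits.Ventures.CertifiedManyBodySolver.Rows.SourcedTorusRowsBridge
import HarnessLib

/-!
# PINNING-FIELD rows, part 4: CONVEX-COMBINATION transport of the sourced energy cells in the pair
# `(μ, h)` — derived floor rows BETWEEN two certified rows, derived cap rows BEYOND a cap and a floor

HONEST FRAMING: zero compute; nothing here is a number; every statement takes certified energy cells of
`Rows/SourcedTorusRows.lean` as hypotheses and returns a cell of the same grammar. A sourced-energy floor
at one `(μ, h)` is never order, never a phase word; not a superconductivity verdict.

Cell `hubbard-cq` (rung CQ, row PC-a «pinning-field response»), seat `hubbard-cq-pilot-2` (the A0 pinning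
menu; lead ★ RULING 268 (1): «DERIVED … until a tree leaf states it»). OBJECT: the pair-sourced
grand-canonical `t–t'` torus `A_L(μ, h) = dWaveSourceTorusTT' L tp U μ h = H^{tt'}_L − μN − h(Δ_d + Δ_d†)`
is AFFINE in the pair `(μ, h)` (`dWaveSourceTorusTT'_convexComb`), and the ground energy of a finite
Hermitian matrix is CONCAVE along affine families (superadditive and positively homogeneous: the tracial
ground state of the combination is a trial state for each summand, `Matrix.groundEnergy_le_groundStateFunctional_re`).
Hence, with rational weights `s, t ≥ 0`, `s + t = 1`:

* §1 `groundEnergy_convexComb_ge`: `s·E₀(A) + t·E₀(B) ≤ E₀(C)` whenever `s•A + t•B = C` (Hermitian `A, B, C`,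
  real `s, t ≥ 0`; no normalisation needed).
* §2 FLOOR rows interpolate: `SourcedEnergyLowerRow tp U μa ha q L₀ ea` and `… μb hb q L₀' eb` give
  `SourcedEnergyLowerRow tp U (s μa + t μb) (s ha + t hb) q (max L₀ L₀') (s ea + t eb)`
  (`SourcedEnergyLowerRow.convexComb`; one-torus form `SourcedTorusEnergyLowerRow.convexComb`; midpoint
  form `….midpoint`). In particular two certified sourced floors at fields `h₁ < h₂` at one `μ` give a floor
  at every rational-weight field in between — the finite-volume, row-level form of the concavity of
  `h ↦ E₀(A_L(h))` (`concaveOn_groundEnergy_dWaveSourceTorusTT'`, obsth-2's TL chords), now JOINT in `(μ, h)`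
  so that rows certified at DIFFERENT filling multipliers `μ⋆` combine (the pilots' canonical-filling rows
  each come with their own `μ⋆ = λ_fill/2`).
* §3 CAP rows extrapolate: a cap `hi` at the combination point and a floor `ea` at one end give the cap
  `(hi − s·ea)/t` at the other end (`SourcedEnergyUpperRow.extrapolate`), `t > 0`.

No definition, no named fact, no `sorry`. The two `DecidableEq (FermionTorus 2 L)` instances (file-local in
`SourcedTorusRows.lean`, library here) are crossed through `SourcedTorusEnergyLowerRow.iff_le_groundEnergy` /
`SourcedTorusEnergyUpperRow.iff_groundEnergy_le` of `SourcedTorusRowsBridge.lean`.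

References: T. Koma, H. Tasaki, J. Stat. Phys. 76 (1994) 745, §1 (concavity of the sourced ground-state
energy in the source) [cite: KomaTasaki1994, §1]; R. B. Griffiths, Phys. Rev. 152 (1966) 240, §II
[cite: Griffiths1966, §II]; H. Tasaki, *Physics and Mathematics of Quantum Many-Body Systems* (2020), §2.1
(variational principle for the ground energy) [cite: Tasaki2020, §2.1].
-/

noncomputable section

namespace Summit.Ventures.CertifiedManyBodySolver

open Literature.MathematicalPhysics.QuantumLattice
open Matrix HubbardWave0 Literature.Probability.LatticeModels
open scoped BigOperators ComplexOrder

/-! ## §1  The ground energy is concave along affine families of Hermitian matrices -/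

section GroundEnergy

variable {n : Type*} [Fintype n] [DecidableEq n] [Nonempty n]

/-- **Concavity of the ground energy along an affine family** (superadditivity + positive homogeneity): for
Hermitian `A, B, C` with `s•A + t•B = C` and real weights `s, t ≥ 0`, `s·E₀(A) + t·E₀(B) ≤ E₀(C)` — the
tracial ground state `ω_C` of `C` is a trial state for `A` and for `B` (`E₀(A) ≤ Re ω_C(A)`,
`E₀(B) ≤ Re ω_C(B)`) and `ω_C(C) = E₀(C)`. [cite: Tasaki2020, §2.1] -/
theorem groundEnergy_convexComb_ge {A B C : Matrix n n ℂ} (hA : A.IsHermitian) (hB : B.IsHermitian)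
    (hC : C.IsHermitian) {s t : ℝ} (hs : 0 ≤ s) (ht : 0 ≤ t) (hABC : (s : ℂ) • A + (t : ℂ) • B = C) :
    s * A.groundEnergy + t * B.groundEnergy ≤ C.groundEnergy := by
  have h1 := Matrix.groundEnergy_le_groundStateFunctional_re hC hA
  have h2 := Matrix.groundEnergy_le_groundStateFunctional_re hC hB
  have h3 : C.groundStateFunctional ((s : ℂ) • A + (t : ℂ) • B) = (C.groundEnergy : ℂ) := by
    rw [hABC]; exact Matrix.groundStateFunctional_hamiltonian hC
  have h4 := congrArg Complex.re h3
  simp only [map_add, map_smul, smul_eq_mul, Complex.add_re, Complex.re_ofReal_mul,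
    Complex.ofReal_re] at h4
  nlinarith [mul_le_mul_of_nonneg_left h1 hs, mul_le_mul_of_nonneg_left h2 ht]

end GroundEnergy

/-! ## §2  The sourced `t–t'` torus is affine in `(μ, h)`; FLOOR rows interpolate -/

section Rows

variable {L : ℕ} [NeZero L] {tp U μa μb ha hb : ℝ} {ea eb hi : ℚ} {q L₀ L₀' : ℕ}

/-- **`A_L(μ, h)` is affine in `(μ, h)`**: for real `s, t` with `s + t = 1`,
`s•A_L(μa, ha) + t•A_L(μb, hb) = A_L(s μa + t μb, s ha + t hb)`. [cite: KomaTasaki1994, §1] -/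
theorem dWaveSourceTorusTT'_convexComb (L : ℕ) [NeZero L] (tp U μa μb ha hb : ℝ) {s t : ℝ} (hst : s + t = 1) :
    (s : ℂ) • dWaveSourceTorusTT' L tp U μa ha + (t : ℂ) • dWaveSourceTorusTT' L tp U μb hb =
      dWaveSourceTorusTT' L tp U (s * μa + t * μb) (s * ha + t * hb) := by
  have hst' : (s : ℂ) + (t : ℂ) = 1 := by exact_mod_cast hst
  unfold dWaveSourceTorusTT'
  push_cast
  linear_combination (norm := module) hst' • hubbardTorusTT' L 1 tp U

/-- **FLOOR cells interpolate (one torus)**: floors `ea` at `(μa, ha)` and `eb` at `(μb, hb)` on the torus of side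
`L` give the floor `s·ea + t·eb` at `(s μa + t μb, s ha + t hb)` for rational `s, t ≥ 0` with `s + t = 1`.
[cite: KomaTasaki1994, §1] -/
theorem SourcedTorusEnergyLowerRow.convexComb (hA : SourcedTorusEnergyLowerRow L tp U μa ha ea)
    (hB : SourcedTorusEnergyLowerRow L tp U μb hb eb) {s t : ℚ} (hs : 0 ≤ s) (ht : 0 ≤ t) (hst : s + t = 1) :
    SourcedTorusEnergyLowerRow L tp U ((s : ℝ) * μa + (t : ℝ) * μb) ((s : ℝ) * ha + (t : ℝ) * hb)
      (s * ea + t * eb) := by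
  rw [SourcedTorusEnergyLowerRow.iff_le_groundEnergy] at hA hB ⊢
  have hst' : (s : ℝ) + (t : ℝ) = 1 := by exact_mod_cast hst
  have key := groundEnergy_convexComb_ge (dWaveSourceTorusTT'_isHermitian L tp U μa ha)
    (dWaveSourceTorusTT'_isHermitian L tp U μb hb)
    (dWaveSourceTorusTT'_isHermitian L tp U ((s : ℝ) * μa + (t : ℝ) * μb) ((s : ℝ) * ha + (t : ℝ) * hb))
    (s := (s : ℝ)) (t := (t : ℝ)) (by exact_mod_cast hs) (by exact_mod_cast ht)
    (by exact_mod_cast dWaveSourceTorusTT'_convexComb L tp U μa μb ha hb hst')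
  have hs' : (0 : ℝ) ≤ (s : ℝ) := by exact_mod_cast hs
  have ht' : (0 : ℝ) ≤ (t : ℝ) := by exact_mod_cast ht
  push_cast
  nlinarith [mul_le_mul_of_nonneg_left hA hs', mul_le_mul_of_nonneg_left hB ht']

/-- **FLOOR rows interpolate (uniform)**: `SourcedEnergyLowerRow tp U μa ha q L₀ ea` and `SourcedEnergyLowerRow tp U μb hb q L₀' eb`
give `SourcedEnergyLowerRow tp U (s μa + t μb) (s ha + t hb) q (max L₀ L₀') (s ea + t eb)` (rational `s, t ≥ 0`, `s + t = 1`).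
Rows certified at DIFFERENT filling multipliers `μ⋆` combine. [cite: KomaTasaki1994, §1] -/
theorem SourcedEnergyLowerRow.convexComb (hA : SourcedEnergyLowerRow tp U μa ha q L₀ ea)
    (hB : SourcedEnergyLowerRow tp U μb hb q L₀' eb) {s t : ℚ} (hs : 0 ≤ s) (ht : 0 ≤ t) (hst : s + t = 1) :
    SourcedEnergyLowerRow tp U ((s : ℝ) * μa + (t : ℝ) * μb) ((s : ℝ) * ha + (t : ℝ) * hb) q (max L₀ L₀')
      (s * ea + t * eb) :=
  fun L _ hL hqL => (hA L ((le_max_left _ _).trans hL) hqL).convexComb (hB L ((le_max_right _ _).trans hL) hqL) hs ht hst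

/-- **MIDPOINT form**: floors `ea` at `(μa, ha)` and `eb` at `(μb, hb)` give the floor `(ea + eb)/2` at
`((μa + μb)/2, (ha + hb)/2)`. [cite: KomaTasaki1994, §1] -/
theorem SourcedEnergyLowerRow.midpoint (hA : SourcedEnergyLowerRow tp U μa ha q L₀ ea)
    (hB : SourcedEnergyLowerRow tp U μb hb q L₀' eb) :
    SourcedEnergyLowerRow tp U ((μa + μb) / 2) ((ha + hb) / 2) q (max L₀ L₀') ((ea + eb) / 2) := by
  have h := hA.convexComb hB (s := 1 / 2) (t := 1 / 2) (by norm_num) (by norm_num) (by norm_num)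
  have e1 : (((1 / 2 : ℚ) : ℝ)) * μa + (((1 / 2 : ℚ) : ℝ)) * μb = (μa + μb) / 2 := by push_cast; ring
  have e2 : (((1 / 2 : ℚ) : ℝ)) * ha + (((1 / 2 : ℚ) : ℝ)) * hb = (ha + hb) / 2 := by push_cast; ring
  have e3 : (1 / 2 : ℚ) * ea + (1 / 2 : ℚ) * eb = (ea + eb) / 2 := by ring
  rw [e1, e2, e3] at h
  exact h

/-- **FLOOR rows interpolate in the field alone** (one `μ`): floors at `h₁` and `h₂` give the floor
`s·ea + t·eb` at `s h₁ + t h₂` — the row-level form of the concavity of `h ↦ E₀(A_L(μ, h))`.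
[cite: KomaTasaki1994, §1] -/
theorem SourcedEnergyLowerRow.convexComb_field {μ h₁ h₂ : ℝ} (hA : SourcedEnergyLowerRow tp U μ h₁ q L₀ ea)
    (hB : SourcedEnergyLowerRow tp U μ h₂ q L₀' eb) {s t : ℚ} (hs : 0 ≤ s) (ht : 0 ≤ t) (hst : s + t = 1) :
    SourcedEnergyLowerRow tp U μ ((s : ℝ) * h₁ + (t : ℝ) * h₂) q (max L₀ L₀') (s * ea + t * eb) := by
  have h := hA.convexComb hB hs ht hst
  have hst' : (s : ℝ) + (t : ℝ) = 1 := by exact_mod_cast hst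
  have e1 : (s : ℝ) * μ + (t : ℝ) * μ = μ := by
    calc (s : ℝ) * μ + (t : ℝ) * μ = ((s : ℝ) + (t : ℝ)) * μ := by ring
      _ = μ := by rw [hst', one_mul]
  rw [e1] at h
  exact h

/-! ## §3  CAP rows extrapolate past a floor -/

/-- **CAP cells extrapolate (one torus)**: a cap `hi` AT the combination point `(s μa + t μb, s ha + t hb)` and a floor
`ea` at the end `(μa, ha)` give the cap `(hi − s·ea)/t` at the other end `(μb, hb)` (`s ≥ 0`, `t > 0`, `s + t = 1`):
`t·E₀(A_b) ≤ E₀(A_comb) − s·E₀(A_a) ≤ hi·L² − s·ea·L²`. [cite: KomaTasaki1994, §1] -/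
theorem SourcedTorusEnergyUpperRow.extrapolate {s t : ℚ} (hs : 0 ≤ s) (ht : 0 < t) (hst : s + t = 1)
    (hcap : SourcedTorusEnergyUpperRow L tp U ((s : ℝ) * μa + (t : ℝ) * μb) ((s : ℝ) * ha + (t : ℝ) * hb) hi)
    (hlo : SourcedTorusEnergyLowerRow L tp U μa ha ea) :
    SourcedTorusEnergyUpperRow L tp U μb hb ((hi - s * ea) / t) := by
  rw [SourcedTorusEnergyUpperRow.iff_groundEnergy_le] at hcap ⊢
  rw [SourcedTorusEnergyLowerRow.iff_le_groundEnergy] at hlo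
  have hst' : (s : ℝ) + (t : ℝ) = 1 := by exact_mod_cast hst
  have key := groundEnergy_convexComb_ge (dWaveSourceTorusTT'_isHermitian L tp U μa ha)
    (dWaveSourceTorusTT'_isHermitian L tp U μb hb)
    (dWaveSourceTorusTT'_isHermitian L tp U ((s : ℝ) * μa + (t : ℝ) * μb) ((s : ℝ) * ha + (t : ℝ) * hb))
    (s := (s : ℝ)) (t := (t : ℝ)) (by exact_mod_cast hs) (by exact_mod_cast ht.le)
    (by exact_mod_cast dWaveSourceTorusTT'_convexComb L tp U μa μb ha hb hst')
  have hs' : (0 : ℝ) ≤ (s : ℝ) := by exact_mod_cast hs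
  have ht' : (0 : ℝ) < (t : ℝ) := by exact_mod_cast ht
  have hL : (0 : ℝ) ≤ (L : ℝ) ^ 2 := by positivity
  have h1 : (t : ℝ) * (dWaveSourceTorusTT' L tp U μb hb).groundEnergy ≤
      ((hi : ℚ) : ℝ) * (L : ℝ) ^ 2 - (s : ℝ) * (((ea : ℚ) : ℝ) * (L : ℝ) ^ 2) := by
    nlinarith [mul_le_mul_of_nonneg_left hlo hs']
  have h2 : (dWaveSourceTorusTT' L tp U μb hb).groundEnergy ≤
      (((hi : ℚ) : ℝ) * (L : ℝ) ^ 2 - (s : ℝ) * (((ea : ℚ) : ℝ) * (L : ℝ) ^ 2)) / (t : ℝ) :=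
    (le_div_iff₀ ht').2 (by linarith)
  calc (dWaveSourceTorusTT' L tp U μb hb).groundEnergy
      ≤ (((hi : ℚ) : ℝ) * (L : ℝ) ^ 2 - (s : ℝ) * (((ea : ℚ) : ℝ) * (L : ℝ) ^ 2)) / (t : ℝ) := h2
    _ = ((((hi - s * ea) / t : ℚ)) : ℝ) * (L : ℝ) ^ 2 := by push_cast; ring

/-- **CAP rows extrapolate (uniform)**: `SourcedEnergyUpperRow` at the combination point and `SourcedEnergyLowerRow` at one end, on the
same side progression, give `SourcedEnergyUpperRow tp U μb hb q (max L₀ L₀') ((hi − s·ea)/t)` at the other end.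
[cite: KomaTasaki1994, §1] -/
theorem SourcedEnergyUpperRow.extrapolate {s t : ℚ} (hs : 0 ≤ s) (ht : 0 < t) (hst : s + t = 1)
    (hcap : SourcedEnergyUpperRow tp U ((s : ℝ) * μa + (t : ℝ) * μb) ((s : ℝ) * ha + (t : ℝ) * hb) q L₀ hi)
    (hlo : SourcedEnergyLowerRow tp U μa ha q L₀' ea) :
    SourcedEnergyUpperRow tp U μb hb q (max L₀ L₀') ((hi - s * ea) / t) :=
  fun L _ hL hqL => SourcedTorusEnergyUpperRow.extrapolate hs ht hst (hcap L ((le_max_left _ _).trans hL) hqL)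
    (hlo L ((le_max_right _ _).trans hL) hqL)

end Rows

end Summit.Ventures.CertifiedManyBodySolver

end
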